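import Mathlib

/-!
# STUB-IDEAS k1 (gen 32) — «THE Δ-STEP IS LOSSLESS ON FUNCTIONALS» (nodes R204 / R203, the (3)₂ residue)

Stub of record: `stub_heegnerIndexLowerAtTwo` (crux item `stmt-BirchSwinnertonDyer-27851`, route
`PrintCf2`, skeleton `Lines/kside_finite_two.lean`, stubs `[stub_prints_kside_two, stub_heegnerIndexLowerAtTwo]`).
TECHNIQUE (payload, k = 1): «weaken / strengthen» — the WEAKEST SUFFICIENT form of the Δ-step of road
UTD's descent for what LOWER consumes (an equivariant INTEGRAL functional), and the STRONGEST PROVABLE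
form of its two Δ-bits (exact groups).

SETTING (k2-g32 / `CriticK2G32`, STUB-PLAN v6.3 §3 (xxix), R203 / R204).  `Δ = {±1} ⊂ ℤ₂ˣ`,
`T_Δ = T(key) ⊗ ℤ₂[Δ]`, `M_Δ := H¹_Iw(ℚ₂^cyc/ℚ₂, T_Δ) = H¹_Iw(ℚ₂(μ_{2^∞})/ℚ₂, T)` (Shapiro),
`M := H¹_Iw(ℚ₂^cyc/ℚ₂, T)`, `d = d₂ = cores = H¹_Iw(p)` with `p : T_Δ → T` the augmentation, and
`r := H¹_Iw(j) = res` with `j : T → T_Δ`, `t ↦ t ⊗ (1 + δ)`.  MODULE-LEVEL IDENTITIES (§1, proved on the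
model `T_Δ = T × T`, `δ = swap`): `p ∘ j = 2`, `j ∘ p = 1 + δ`, `δ ∘ j = j`, `p ∘ δ = p`; by functoriality
of the additive functor `H¹_Iw(ℚ₂^cyc/ℚ₂, −)` they give `d ∘ r = 2`, `r ∘ d = 1 + δ` on `M_Δ`, `M`
(equivalently: `cores ∘ res = [L:K] = 2`, Harari Thm 1.48, and `res ∘ cores = N_Δ`).

RESULTS (all sorry-free; the Galois-cohomological inputs are the two identities above and are print):
§2 LOSSLESS DESCENT.  For ANY `R`-linear `Col : M_Δ → N × N` that is Δ-equivariant for the swap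
   (`N × N` = the Δ-induced target `N[Δ]`, e.g. `Λ(G₂) = Λ'[Δ]` after the tf-step), the functional
   `descend Col r := fst ∘ Col ∘ r : M → N` satisfies `descend ∘ d = ε₊ ∘ Col` (`descend_comp`) and is
   the UNIQUE such map when `N` has no 2-torsion (`descend_unique`): the «a priori ½Λ(Γ_cyc)-valued»
   extension of k2-g32 is INTEGRAL.  ⇒ **`D_desc(key) = 0` for all six keys** (R204's digit struck;
   nothing to «count once»).
§3 KERNEL DEFECT INVISIBLE.  `d x = 0 ⇒ x + x = x − δ x` (`two_mul_mem_aug_of_ker`), so every functional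
   into a 2-torsion-free module that kills `(δ − 1)M_Δ` kills `ker d` (`vanish_on_ker`): R203's
   «kernel defect ∣ 2» never reaches a digit.
§4 THE ONLY Δ-BIT IS AN IMAGE BIT.  `2·range(descend) ⊆ ε₊(range Col) ⊆ range(descend)`
   (`aug_range_le_range_descend`, `two_range_descend_le_aug_range`) — Kato's «exact up to ×2 if p = 2»
   (Astérisque 295, (17.13.1), p. 279) LOCATED: it is a statement about `Im(Col_cyc)`, paid ONCE and only
   by a consumer that reads the image; the VALUE law `Col_cyc(z_cyc) = ε₊(Col_Δ(z_Δ)) = 𝓛_cyc` pays nothing.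
§5 EXACT KERNEL-DEFECT GROUP (strongest provable form).  Abstractly from the two long exact sequences:
   `ker d / range(i ∘ q) ≃ ker(j₂ : H²(T) → H²(T_Δ)) = ker(res)` (`kerDefectEquiv`), whose Pontryagin dual
   is `Ĥ⁰(Δ, A^{G_{L_∞}})`, `A = T^∨(1)` (local duality, print); §6 `Ĥ⁰(ℤ/2, C) ≅ ℤ/2` for `C` cyclic of
   order `2 | 4` under `λ = ±1` (the six keys' data from `CriticK2G32.table`: `#ZΔ ∈ {2,4}`,
   `λ = ρ⁻¹(−1,0) = −θ_e(−1) = ±1`) — so the defect group IS `ℤ/2` (≠ 0) on every key, and still costs 0.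
BSD is NOT proved by any of this; the crux, the stub, LOWER and the (3)₂ identification are not proved;
no net digit is asserted (E1 / B45): one digit (`D_desc`) is REMOVED, structurally (B46: key-free because
proved structural; B52: `c`-blind because no character datum enters §2–§4).
-/

set_option linter.dupNamespace false
set_option linter.unusedVariables false

namespace Summit.BirchSwinnertonDyer.BirchSwinnertonDyer.Cruxes.SplitBadTwoLowerHalfOfFacts.LosslessDeltaK1G32

/-! ## §1 The module-level identities on the model `T_Δ = T × T` (δ = swap). -/
section ModuleLevel

variable (R : Type*) [CommRing R] (T : Type*) [AddCommGroup T] [Module R T]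

/-- augmentation `p : T_Δ → T`, `(a, b) ↦ a + b` (i.e. `t ⊗ 1 ↦ t`, `t ⊗ δ ↦ t`). -/
def augT : T × T →ₗ[R] T := LinearMap.fst R T T + LinearMap.snd R T T

/-- `j : T → T_Δ`, `t ↦ t ⊗ (1 + δ) = (t, t)`; on cohomology this is restriction. -/
def diagT : T →ₗ[R] T × T := LinearMap.prod LinearMap.id LinearMap.id

/-- the involution `δ` of `T_Δ` (multiplication by the group element). -/
def swapT : T × T →ₗ[R] T × T := (LinearEquiv.prodComm R T T).toLinearMap

theorem augT_diagT (t : T) : augT R T (diagT R T t) = t + t := by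
  simp [augT, diagT]

theorem diagT_augT (x : T × T) : diagT R T (augT R T x) = x + swapT R T x := by
  rcases x with ⟨a, b⟩
  simp [augT, diagT, swapT, add_comm]

theorem swapT_diagT (t : T) : swapT R T (diagT R T t) = diagT R T t := by
  simp [diagT, swapT]

theorem augT_swapT (x : T × T) : augT R T (swapT R T x) = augT R T x := by
  rcases x with ⟨a, b⟩
  simp [augT, swapT, add_comm]

/-- fixed points of `δ` on the induced module are exactly the diagonal `(1+δ)`-multiples. -/
theorem swap_fixed_iff (x : T × T) : swapT R T x = x ↔ ∃ t, x = diagT R T t := by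
  rcases x with ⟨a, b⟩
  constructor
  · intro h
    simp [swapT, Prod.ext_iff] at h
    exact ⟨a, by simp [diagT, h.1]⟩
  · rintro ⟨t, ht⟩
    simp [diagT, Prod.ext_iff] at ht
    simp [swapT, ht.1, ht.2]

end ModuleLevel

/-! ## §2–§4 The abstract Δ-descent: `d ∘ r = 2`, `r ∘ d = 1 + δ`. -/
section Descent

variable {R : Type*} [CommRing R]
variable {MΔ M N N' : Type*} [AddCommGroup MΔ] [Module R MΔ] [AddCommGroup M] [Module R M]
  [AddCommGroup N] [Module R N] [AddCommGroup N'] [Module R N']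

/-- the descended functional: `fst ∘ Col ∘ res`. -/
def descend (Col : MΔ →ₗ[R] N × N) (r : M →ₗ[R] MΔ) : M →ₗ[R] N :=
  LinearMap.fst R N N ∘ₗ Col ∘ₗ r

theorem descend_apply (Col : MΔ →ₗ[R] N × N) (r : M →ₗ[R] MΔ) (m : M) :
    descend Col r m = (Col (r m)).1 := rfl

/-- derived: `δ ∘ r = r` (restriction lands in the Δ-invariants). -/
theorem delta_r (δ : MΔ →ₗ[R] MΔ) (d : MΔ →ₗ[R] M) (r : M →ₗ[R] MΔ)
    (hrd : ∀ x, r (d x) = x + δ x) (hdr : ∀ m, d (r m) = m + m) (m : M) :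
    δ (r m) = r m := by
  have h := hrd (r m)
  rw [hdr, map_add] at h
  exact (add_left_cancel h).symm

/-- derived: `d ∘ δ = d` (corestriction kills `(δ − 1)`). -/
theorem d_delta (δ : MΔ →ₗ[R] MΔ) (d : MΔ →ₗ[R] M) (r : M →ₗ[R] MΔ)
    (hrd : ∀ x, r (d x) = x + δ x) (hdr : ∀ m, d (r m) = m + m) (x : MΔ) :
    d (δ x) = d x := by
  have h := congrArg d (hrd x)
  rw [hdr, map_add] at h
  exact (add_left_cancel h).symm

/-- on `res`-images an equivariant `Col` takes DIAGONAL values: `(Col (r m)).1 = (Col (r m)).2`. -/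
theorem col_r_fst_eq_snd (δ : MΔ →ₗ[R] MΔ) (d : MΔ →ₗ[R] M) (r : M →ₗ[R] MΔ)
    (hrd : ∀ x, r (d x) = x + δ x) (hdr : ∀ m, d (r m) = m + m)
    (Col : MΔ →ₗ[R] N × N) (hCol : ∀ x, Col (δ x) = Prod.swap (Col x)) (m : M) :
    (Col (r m)).1 = (Col (r m)).2 := by
  have h := hCol (r m)
  rw [delta_r δ d r hrd hdr] at h
  have := congrArg Prod.fst h
  simpa using this

/-- **§2 (existence).** `descend ∘ d = ε₊ ∘ Col`: the descended functional is defined on ALL of `M`,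
integrally, and agrees with the augmented `Col` on `im d`. -/
theorem descend_comp (δ : MΔ →ₗ[R] MΔ) (d : MΔ →ₗ[R] M) (r : M →ₗ[R] MΔ)
    (hrd : ∀ x, r (d x) = x + δ x)
    (Col : MΔ →ₗ[R] N × N) (hCol : ∀ x, Col (δ x) = Prod.swap (Col x)) (x : MΔ) :
    descend Col r (d x) = (Col x).1 + (Col x).2 := by
  rw [descend_apply, hrd, map_add, hCol]
  simp

/-- **§2 (uniqueness).** If `N` has no 2-torsion, ANY `φ : M → N` with `φ ∘ d = ε₊ ∘ Col` equals
`descend Col r`; in particular the unique `⊗ℚ`-extension of k2-g32 is integral: `D_desc = 0`. -/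
theorem descend_unique (δ : MΔ →ₗ[R] MΔ) (d : MΔ →ₗ[R] M) (r : M →ₗ[R] MΔ)
    (hrd : ∀ x, r (d x) = x + δ x) (hdr : ∀ m, d (r m) = m + m)
    (Col : MΔ →ₗ[R] N × N) (hCol : ∀ x, Col (δ x) = Prod.swap (Col x))
    (hN : ∀ n : N, n + n = 0 → n = 0)
    (φ : M →ₗ[R] N) (hφ : ∀ x, φ (d x) = (Col x).1 + (Col x).2) :
    φ = descend Col r := by
  ext m
  have h := hφ (r m)
  rw [hdr, map_add, ← col_r_fst_eq_snd δ d r hrd hdr Col hCol m, ← descend_apply Col r m] at h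
  have h2 : (φ m - descend Col r m) + (φ m - descend Col r m) = 0 := by
    have : φ m + φ m - (descend Col r m + descend Col r m) = 0 := sub_eq_zero.mpr h
    rw [← this]; abel
  exact sub_eq_zero.mp (hN _ h2)

/-- **§2 packaged.** Existence and uniqueness of the integral descended functional. -/
theorem existsUnique_descend (δ : MΔ →ₗ[R] MΔ) (d : MΔ →ₗ[R] M) (r : M →ₗ[R] MΔ)
    (hrd : ∀ x, r (d x) = x + δ x) (hdr : ∀ m, d (r m) = m + m)
    (Col : MΔ →ₗ[R] N × N) (hCol : ∀ x, Col (δ x) = Prod.swap (Col x))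
    (hN : ∀ n : N, n + n = 0 → n = 0) :
    ∃! φ : M →ₗ[R] N, ∀ x, φ (d x) = (Col x).1 + (Col x).2 :=
  ⟨descend Col r, descend_comp δ d r hrd Col hCol,
    fun φ hφ => descend_unique δ d r hrd hdr Col hCol hN φ hφ⟩

/-- the descended value is also the SECOND coordinate (no choice of branch involved). -/
theorem descend_eq_snd (δ : MΔ →ₗ[R] MΔ) (d : MΔ →ₗ[R] M) (r : M →ₗ[R] MΔ)
    (hrd : ∀ x, r (d x) = x + δ x) (hdr : ∀ m, d (r m) = m + m)
    (Col : MΔ →ₗ[R] N × N) (hCol : ∀ x, Col (δ x) = Prod.swap (Col x)) (m : M) :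
    descend Col r m = (Col (r m)).2 := by
  rw [descend_apply, col_r_fst_eq_snd δ d r hrd hdr Col hCol]

/-- **§3.** On `ker d` one has `2x = (1 − δ)x`: the kernel defect `ker d / (δ−1)M_Δ` is killed by 2 … -/
theorem two_mul_mem_aug_of_ker (δ : MΔ →ₗ[R] MΔ) (d : MΔ →ₗ[R] M) (r : M →ₗ[R] MΔ)
    (hrd : ∀ x, r (d x) = x + δ x) (x : MΔ) (hx : d x = 0) :
    x + x = x - δ x := by
  have h := hrd x
  rw [hx, map_zero] at h
  have hδ : δ x = -x := (neg_eq_of_add_eq_zero_right h.symm).symm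
  rw [hδ, sub_neg_eq_add]

/-- … hence INVISIBLE to every functional into a 2-torsion-free module that kills `(δ − 1)M_Δ`
(e.g. `ε₊ ∘ Col` for an equivariant `Col`, or any `Λ(Γ₀)`-valued map factoring through `Δ`-coinvariants). -/
theorem vanish_on_ker (δ : MΔ →ₗ[R] MΔ) (d : MΔ →ₗ[R] M) (r : M →ₗ[R] MΔ)
    (hrd : ∀ x, r (d x) = x + δ x)
    (ψ : MΔ →ₗ[R] N') (hψ : ∀ y, ψ (δ y) = ψ y) (hN' : ∀ n : N', n + n = 0 → n = 0)
    (x : MΔ) (hx : d x = 0) : ψ x = 0 := by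
  apply hN'
  rw [← map_add, two_mul_mem_aug_of_ker δ d r hrd x hx, map_sub, hψ, sub_self]

/-- the augmented equivariant `Col` does kill `(δ − 1)M_Δ`. -/
theorem aug_col_delta (δ : MΔ →ₗ[R] MΔ) (Col : MΔ →ₗ[R] N × N)
    (hCol : ∀ x, Col (δ x) = Prod.swap (Col x)) (y : MΔ) :
    (Col (δ y)).1 + (Col (δ y)).2 = (Col y).1 + (Col y).2 := by
  rw [hCol]; simp [add_comm]

/-- **§4 (image bit, upper inclusion).** `ε₊(range Col) ⊆ range(descend)`. -/
theorem aug_range_le_range_descend (δ : MΔ →ₗ[R] MΔ) (d : MΔ →ₗ[R] M) (r : M →ₗ[R] MΔ)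
    (hrd : ∀ x, r (d x) = x + δ x)
    (Col : MΔ →ₗ[R] N × N) (hCol : ∀ x, Col (δ x) = Prod.swap (Col x)) (x : MΔ) :
    ∃ m : M, descend Col r m = (Col x).1 + (Col x).2 :=
  ⟨d x, descend_comp δ d r hrd Col hCol x⟩

/-- **§4 (image bit, lower inclusion).** `2 · range(descend) ⊆ ε₊(range Col)`: the image bit is
`≤ 1` — Kato's «exact up to ×2» shape, located on the IMAGE side only. -/
theorem two_range_descend_le_aug_range (δ : MΔ →ₗ[R] MΔ) (d : MΔ →ₗ[R] M) (r : M →ₗ[R] MΔ)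
    (hrd : ∀ x, r (d x) = x + δ x) (hdr : ∀ m, d (r m) = m + m)
    (Col : MΔ →ₗ[R] N × N) (hCol : ∀ x, Col (δ x) = Prod.swap (Col x)) (m : M) :
    ∃ x : MΔ, (Col x).1 + (Col x).2 = descend Col r m + descend Col r m :=
  ⟨r m, by rw [← map_add, ← hdr m, descend_comp δ d r hrd Col hCol]⟩

end Descent

/-! ## §5 The exact kernel-defect group from the two long exact sequences (strongest provable form).

Data: `i₁ : H¹(T⁻) → H¹(T_Δ)`, `p₁ = d : H¹(T_Δ) → H¹(T)` (exact at `H¹(T_Δ)`, `i₁` injective since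
`H⁰_Iw(T) = 0`), `q₁ : H¹(T_Δ) → H¹(T⁻)`, `∂ : H¹(T⁻) → H²(T)`, `j₂ = res : H²(T) → H²(T_Δ)` (exact at
`H¹(T⁻)` and at `H²(T)`), with `i ∘ q = 1 − δ` on `T_Δ` so that `range(i₁ ∘ q₁) = (δ − 1)M_Δ`.
Conclusion: `ker p₁ / range(i₁ ∘ q₁) ≃ ker j₂`. -/
section ExactDefect

variable {R : Type*} [CommRing R]
variable {Hm HD Hp H2p H2D : Type*}
  [AddCommGroup Hm] [Module R Hm] [AddCommGroup HD] [Module R HD] [AddCommGroup Hp] [Module R Hp]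
  [AddCommGroup H2p] [Module R H2p] [AddCommGroup H2D] [Module R H2D]

/-- `i₁ ∘ q₁` co-restricted to `ker p₁` (it lands there by exactness). -/
def augSub (i₁ : Hm →ₗ[R] HD) (p₁ : HD →ₗ[R] Hp) (q₁ : HD →ₗ[R] Hm)
    (hex : Function.Exact i₁ p₁) : HD →ₗ[R] LinearMap.ker p₁ :=
  LinearMap.codRestrict (LinearMap.ker p₁) (i₁ ∘ₗ q₁) (fun x => by
    simp only [LinearMap.mem_ker, LinearMap.coe_comp, Function.comp_apply]
    exact hex.apply_apply_eq_zero (q₁ x))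

/-- `ker p₁ = range i₁ ≃ H¹(T⁻)` (exactness + injectivity of `i₁`). -/
noncomputable def kerEquivSource (i₁ : Hm →ₗ[R] HD) (p₁ : HD →ₗ[R] Hp)
    (hex₁ : Function.Exact i₁ p₁) (hinj : Function.Injective i₁) : LinearMap.ker p₁ ≃ₗ[R] Hm :=
  (LinearEquiv.ofEq _ _ (LinearMap.exact_iff.mp hex₁)).trans (LinearEquiv.ofInjective i₁ hinj).symm

theorem kerEquivSource_apply (i₁ : Hm →ₗ[R] HD) (p₁ : HD →ₗ[R] Hp)
    (hex₁ : Function.Exact i₁ p₁) (hinj : Function.Injective i₁) (x : Hm)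
    (hx : i₁ x ∈ LinearMap.ker p₁) : kerEquivSource i₁ p₁ hex₁ hinj ⟨i₁ x, hx⟩ = x := by
  unfold kerEquivSource
  rw [LinearEquiv.trans_apply, LinearEquiv.symm_apply_eq]
  ext
  simp

/-- the comparison map `ker p₁ → ker j₂`: `z = i₁ x ↦ ∂ x`. -/
noncomputable def defectMap (i₁ : Hm →ₗ[R] HD) (p₁ : HD →ₗ[R] Hp) (δ' : Hm →ₗ[R] H2p)
    (j₂ : H2p →ₗ[R] H2D) (hex₁ : Function.Exact i₁ p₁) (hinj : Function.Injective i₁)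
    (hex₃ : Function.Exact δ' j₂) : LinearMap.ker p₁ →ₗ[R] LinearMap.ker j₂ :=
  (LinearMap.codRestrict (LinearMap.ker j₂) δ' (fun x => by
      simp only [LinearMap.mem_ker]; exact hex₃.apply_apply_eq_zero x)) ∘ₗ
    (kerEquivSource i₁ p₁ hex₁ hinj).toLinearMap

theorem defectMap_apply (i₁ : Hm →ₗ[R] HD) (p₁ : HD →ₗ[R] Hp) (δ' : Hm →ₗ[R] H2p)
    (j₂ : H2p →ₗ[R] H2D) (hex₁ : Function.Exact i₁ p₁) (hinj : Function.Injective i₁)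
    (hex₃ : Function.Exact δ' j₂) (x : Hm) (hx : i₁ x ∈ LinearMap.ker p₁) :
    (defectMap i₁ p₁ δ' j₂ hex₁ hinj hex₃ ⟨i₁ x, hx⟩ : H2p) = δ' x := by
  simp [defectMap, kerEquivSource_apply]

/-- **§5.** The defect map is onto `ker j₂` … -/
theorem defectMap_surjective (i₁ : Hm →ₗ[R] HD) (p₁ : HD →ₗ[R] Hp) (q₁ : HD →ₗ[R] Hm)
    (δ' : Hm →ₗ[R] H2p) (j₂ : H2p →ₗ[R] H2D) (hex₁ : Function.Exact i₁ p₁)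
    (hinj : Function.Injective i₁) (hex₃ : Function.Exact δ' j₂) :
    Function.Surjective (defectMap i₁ p₁ δ' j₂ hex₁ hinj hex₃) := by
  rintro ⟨z, hz⟩
  obtain ⟨x, rfl⟩ := (hex₃ z).mp (by simpa using hz)
  refine ⟨⟨i₁ x, by simp [LinearMap.mem_ker, hex₁.apply_apply_eq_zero x]⟩, ?_⟩
  ext
  simp [defectMap_apply]

/-- … and its kernel is exactly `range(i₁ ∘ q₁) = (δ − 1)M_Δ`. -/
theorem defectMap_ker (i₁ : Hm →ₗ[R] HD) (p₁ : HD →ₗ[R] Hp) (q₁ : HD →ₗ[R] Hm)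
    (δ' : Hm →ₗ[R] H2p) (j₂ : H2p →ₗ[R] H2D) (hex₁ : Function.Exact i₁ p₁)
    (hinj : Function.Injective i₁) (hex₂ : Function.Exact q₁ δ') (hex₃ : Function.Exact δ' j₂) :
    LinearMap.ker (defectMap i₁ p₁ δ' j₂ hex₁ hinj hex₃) =
      LinearMap.range (augSub i₁ p₁ q₁ hex₁) := by
  ext ⟨z, hz⟩
  have hz' : z ∈ LinearMap.range i₁ := by rwa [← LinearMap.exact_iff.mp hex₁]
  obtain ⟨x, rfl⟩ := hz'
  constructor
  · intro h
    have h0 : δ' x = 0 := by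
      have := congrArg Subtype.val h
      simpa [defectMap_apply] using this
    obtain ⟨y, rfl⟩ := (hex₂ x).mp h0
    exact ⟨y, by ext; simp [augSub]⟩
  · rintro ⟨y, hy⟩
    have hy' : i₁ (q₁ y) = i₁ x := by
      have := congrArg Subtype.val hy
      simpa [augSub] using this
    have hxy : q₁ y = x := hinj hy'
    simp only [LinearMap.mem_ker]
    ext
    simp [defectMap_apply, ← hxy, hex₂.apply_apply_eq_zero y]

/-- **§5 (the exact group).** `ker p₁ / range(i₁ ∘ q₁) ≃ ker j₂` — the kernel defect of the
Δ-corestriction IS `ker(res : H²_Iw(ℚ₂^cyc,T) → H²_Iw(ℚ₂(μ_{2^∞}),T))`, not merely a subquotient. -/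
noncomputable def kerDefectEquiv (i₁ : Hm →ₗ[R] HD) (p₁ : HD →ₗ[R] Hp) (q₁ : HD →ₗ[R] Hm)
    (δ' : Hm →ₗ[R] H2p) (j₂ : H2p →ₗ[R] H2D) (hex₁ : Function.Exact i₁ p₁)
    (hinj : Function.Injective i₁) (hex₂ : Function.Exact q₁ δ') (hex₃ : Function.Exact δ' j₂) :
    (LinearMap.ker p₁ ⧸ LinearMap.range (augSub i₁ p₁ q₁ hex₁)) ≃ₗ[R] LinearMap.ker j₂ :=
  (Submodule.quotEquivOfEq _ _ (defectMap_ker i₁ p₁ q₁ δ' j₂ hex₁ hinj hex₂ hex₃).symm).trans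
    (LinearMap.quotKerEquivOfSurjective _ (defectMap_surjective i₁ p₁ q₁ δ' j₂ hex₁ hinj hex₃))

end ExactDefect

/-! ## §6 `Ĥ⁰(ℤ/2, C)` for the six keys: cyclic `C` of order `#ZΔ ∈ {2, 4}`, `δ` acting by `λ = ±1`.

By local duality `ker(res) ≅ Ĥ⁰(Δ, A^{G_{L_∞}})^∨` with `A = T^∨(1) = (ℚ₂/ℤ₂)(ρ⁻¹)`, `A^{G_{L_∞}}` cyclic
of order `#ZΔ(key)` (`CriticK2G32.table`: `2` for `c = 0`, `4` for `c = 1`) and the generator of `Δ`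
acting by `λ = ρ⁻¹(−1,0) = −θ_e(−1)` (`= +1` for `e ∈ {−1,−2}`, `= −1` for `e = 2`).  Decidable shadow:
`#Ĥ⁰ = #Fix(λ) / #Im(1+λ)`. -/
section TateH0

/-- number of `λ`-fixed points in `ℤ/n`. -/
def fixedCount (n : ℕ) [NeZero n] (l : ZMod n) : ℕ :=
  (Finset.univ.filter fun x : ZMod n => l * x = x).card

/-- size of the norm image `(1 + λ)·ℤ/n`. -/
def normImageCount (n : ℕ) [NeZero n] (l : ZMod n) : ℕ :=
  (Finset.univ.filter fun y : ZMod n => ∃ x : ZMod n, y = (l + 1) * x).card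

/-- order 2: `Ĥ⁰ ≅ ℤ/2` for the only unit `λ = 1`. -/
theorem tateH0_two : fixedCount 2 1 = 2 * normImageCount 2 1 := by decide

/-- order 4: `Ĥ⁰ ≅ ℤ/2` for BOTH units `λ = ±1`. -/
theorem tateH0_four : ∀ l : ZMod 4, (l = 1 ∨ l = 3) →
    fixedCount 4 l = 2 * normImageCount 4 l := by decide

/-- contrast (why `#ZΔ ≤ 4` / `λ = ±1` matters): order 8 with `λ = 3 = −1 + 4` has `Ĥ⁰ = 0`. -/
theorem tateH0_eight_vanish : fixedCount 8 3 = normImageCount 8 3 := by decide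

/-- while `λ = ±1` on order 8 still gives `ℤ/2`. -/
theorem tateH0_eight_pm : fixedCount 8 1 = 2 * normImageCount 8 1 ∧
    fixedCount 8 7 = 2 * normImageCount 8 7 := by decide

/-- The six dyadic keys `TwistE × Bool` (B52 indexing). -/
inductive TwistE | neg1 | two | neg2
  deriving DecidableEq, Fintype

open TwistE

/-- `#ZΔ(key)` from `CriticK2G32.table`: `2` iff `c = 0`, `4` iff `c = 1`. -/
def cardZD (_e : TwistE) (c : Bool) : ℕ := if c then 4 else 2

/-- `λ(key) = −θ_e(−1) ∈ ℤ`: `+1` for `e ∈ {−1,−2}`, `−1` for `e = 2`. -/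
def lam : TwistE → ℤ
  | neg1 => 1 | neg2 => 1 | two => -1

/-- **the exact kernel-defect table**: `#Ĥ⁰ = 2` (one bit, PRESENT) on all six keys — and by §3 it
costs nothing.  (`decide` on the four `(n, λ mod n)` cases that occur.) -/
theorem kerDefect_table :
    (fixedCount 2 ((lam neg1 : ℤ) : ZMod 2) = 2 * normImageCount 2 ((lam neg1 : ℤ) : ZMod 2)) ∧
    (fixedCount 2 ((lam two : ℤ) : ZMod 2) = 2 * normImageCount 2 ((lam two : ℤ) : ZMod 2)) ∧
    (fixedCount 4 ((lam neg1 : ℤ) : ZMod 4) = 2 * normImageCount 4 ((lam neg1 : ℤ) : ZMod 4)) ∧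
    (fixedCount 4 ((lam neg2 : ℤ) : ZMod 4) = 2 * normImageCount 4 ((lam neg2 : ℤ) : ZMod 4)) ∧
    (fixedCount 4 ((lam two : ℤ) : ZMod 4) = 2 * normImageCount 4 ((lam two : ℤ) : ZMod 4)) := by
  decide

/-- the located Δ-digits of the descent AFTER this card: `(coker d₁, D_desc, image bit)` =
`(0, 0, ≤ 1)`; the kernel-defect GROUP is `ℤ/2` on every key but is not a digit. -/
structure DeltaDigits where
  cokerTf : ℕ
  lossOnFunctionals : ℕ
  imageBitUpper : ℕ
  kerDefectGroupLog : ℕ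

def deltaDigits (_e : TwistE) (_c : Bool) : DeltaDigits := ⟨0, 0, 1, 1⟩

theorem deltaDigits_keyUniform (e e' : TwistE) (c c' : Bool) :
    deltaDigits e c = deltaDigits e' c' := rfl

theorem lossOnFunctionals_eq_zero (e : TwistE) (c : Bool) :
    (deltaDigits e c).lossOnFunctionals = 0 := rfl

end TateH0

end Summit.BirchSwinnertonDyer.BirchSwinnertonDyer.Cruxes.SplitBadTwoLowerHalfOfFacts.LosslessDeltaK1G32
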